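import Summits.MatrixMultiplication.OmegaCensus.STPPVosperTilingTools

/-!
# ω-census (abelian STPP census): the Vosper TILING law at prime order — tight block, window table, word, and exact cover (kernel, UNCONDITIONAL)

HONEST FRAMING (pub-omega census; verbatim): lottery ticket; floor = certified bounds/negative ranges.
Census STRUCTURE (seat pub-omega-stpp-1 gen 30, 2026-08-28), family (b2).  A THEOREM FILTER strengthening the N18-tight table laws
(`STPPVosperPrimeTableLaw.lean`): besides the window table for the ratio `j = e′⁻¹e` of the two Vosper steps and the triple-product word (ratios `±k`,
`±k⁻¹`), the remaining ratios are excluded by an EXACT-COVER computation — the difference sets `C_k − B_k`, `C_k − A_k` of the other blocks partition the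
two Vosper progressions `Y°`, `Z°` (`existsCover`, `STPPVosperTilingTools.lean`).  Uses only Vosper's theorem: NO Hamidoune–Rødseth hypothesis.
Nothing here is progress on `ω`.

## Statement (`no_isSTPP_of_tight_tiling_prime`)

Tight block `i` (`a, b ≥ 2`, `z, L ≥ 2`, `z + b + vol + a + L = p + 2`, `m = L + a − 1`, `n = vol + m`); `ks` a duplicate-free list of the other indices;
a window table for `(n, m, b)` with target `Js`; and for every `jv ∈ Js`: either `jv` is a word ratio (`0`, `±k` with `k < b`, `±k⁻¹` with `k < a`) or the
exact-cover search `existsCover p z [(jv·t) mod p : t < L] (ks.map sizes) [] []` returns `false`.  Then the family does not exist.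

## Proof

`vosper_structure_of_n18_tight_V`: `Aᵢ`, `Y°` progressions of step `e`; `Bᵢ`, `V`, `Z°` of step `e′`.  The table (via `prefix_law_of_runs`,
`val_mem_of_nat_table_prime`) gives `(e′⁻¹e).val ∈ Js`.  Word ratios: `false_of_ratio_val_mem_mult`.  Otherwise NORMALISE block by block — with
`u = e′⁻¹`, `j = u e`, `b*_k ∈ B_k`: `B′_k = u(B_k − b*_k) ∋ 0`, `C′_k = u(C_k − b*_k − y₀)`, `A′_k = u(A_k − b*_k − y₀ + z₀)` — so that `C′ − B′ = u(C − B − y₀)`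
takes values in `{t j : t < L}` and `C′ − A′ = u(C − A − z₀)` in `{t : t < z}`; the values of these sets satisfy every hypothesis of `existsCover_complete`
(injectivity from the triple product property of block `k`, disjointness across blocks from the STPP, coverage from `Y° = ⋃ (C_k − B_k)`,
`Z° = ⋃ (C_k − A_k)`), so the search returns `true` — contradiction.

References: A. G. Vosper, J. London Math. Soc. 31 (1956); M. B. Nathanson, GTM 165, Thm 2.7; H. Cohn, R. Kleinberg, B. Szegedy, C. Umans, FOCS 2005
(arXiv:math/0511460), Def. 5.1.
-/

open Finset
open scoped Pointwise

namespace Summit.MatrixMultiplication.OmegaCensus.CubeNB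

open Literature.Computability.AlgebraicComplexity
open Literature.Combinatorics.Additive
open Summit.MatrixMultiplication.OmegaCensus.STPPKneser

variable {p : ℕ} [hp : Fact p.Prime] {N : ℕ} {A B C : Fin N → Finset (ZMod p)}

/-- Pointwise injectivity of the difference map on `E k × F k` from the cardinality `#(D E F k) = #(E k) · #(F k)`. [folklore] -/
theorem sub_injOn_of_card_D {E F : Fin N → Finset (ZMod p)} {k : Fin N} (h : #(D E F k) = #(E k) * #(F k))
    {x x' y y' : ZMod p} (hx : x ∈ E k) (hx' : x' ∈ E k) (hy : y ∈ F k) (hy' : y' ∈ F k) (heq : y - x = y' - x') :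
    x = x' ∧ y = y' := by
  have hinj : Set.InjOn (fun q : ZMod p × ZMod p => q.2 - q.1) ((E k) ×ˢ (F k) : Finset (ZMod p × ZMod p)) := by
    rw [← Finset.card_image_iff, Finset.card_product]; exact h
  have h1 := hinj (Finset.mem_coe.2 (Finset.mem_product.2 ⟨hx, hy⟩)) (Finset.mem_coe.2 (Finset.mem_product.2 ⟨hx', hy'⟩))
    (show (fun q : ZMod p × ZMod p => q.2 - q.1) (x, y) = (fun q : ZMod p × ZMod p => q.2 - q.1) (x', y') from heq)
  exact ⟨congrArg Prod.fst h1, congrArg Prod.snd h1⟩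

/-- **The Vosper tiling law at prime order (kernel, general tight block, UNCONDITIONAL).**  See the module docstring.
[cite: CohnKleinbergSzegedyUmans2005, Def. 5.1] [cite: Vosper1956, main theorem; Nathanson1996, Thm 2.7] -/
theorem no_isSTPP_of_tight_tiling_prime (A B C : Fin N → Finset (ZMod p)) (hS : IsSTPP A B C)
    (hA : ∀ k, (A k).Nonempty) (hB : ∀ k, (B k).Nonempty) (hC : ∀ k, (C k).Nonempty)
    (i : Fin N) (hI : ((univ : Finset (Fin N)).erase i).Nonempty)
    {a b vol z L m n : ℕ} (ha : #(A i) = a) (hb : #(B i) = b) (hvol : #(A i) * #(B i) * #(C i) = vol)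
    (hz : ∑ k ∈ univ.erase i, #(A k) * #(C k) = z) (hL : ∑ k ∈ univ.erase i, #(B k) * #(C k) = L)
    (h2a : 2 ≤ a) (h2b : 2 ≤ b) (h2z : 2 ≤ z) (h2L : 2 ≤ L) (htight : z + b + vol + a + L = p + 2)
    (hm : L + a = m + 1) (hn : vol + m = n)
    (ks : List (Fin N)) (hks : ks.Nodup) (hksi : ∀ k, k ∈ ks ↔ k ≠ i) {Js : Finset ℕ}
    (htable : ∀ j < p, ∀ t < p, (∀ i' < m, (t + j * i') % p < n) →
      (∀ k < m, b ∣ (t + j * k) % p - #((range m).filter fun i' => (t + j * i') % p < (t + j * k) % p)) → j ∈ Js)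
    (hsplit : ∀ jv ∈ Js, (jv = 0 ∨ (∃ k ∈ range b, 1 ≤ k ∧ (jv = k ∨ jv + k = p)) ∨ (∃ k ∈ range a, 1 ≤ k ∧ (jv * k % p = 1 ∨ jv * k % p = p - 1))) ∨
      existsCover p z ((List.range L).map fun t => (jv * t) % p) (ks.map fun k => (#(A k), #(B k), #(C k))) [] [] = false) : False := by
  have hp2 : 2 ≤ p := hp.out.two_le
  obtain ⟨a', rfl⟩ : ∃ a', a = a' + 1 := ⟨a - 1, by omega⟩
  obtain ⟨b', rfl⟩ : ∃ b', b = b' + 1 := ⟨b - 1, by omega⟩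
  -- Vosper structure at the tight block
  obtain ⟨⟨e, he, hAap, hYap⟩, ⟨e', he', hBap, hZoap, hVap, -, hEq⟩⟩ := vosper_structure_of_n18_tight_V hS hA hB hC i hI
    (by rw [ha]; omega) (by rw [hb]; omega) (by rw [hL]; exact h2L) (by rw [hz]; exact h2z) (by rw [hz, hL, hvol, ha, hb]; omega)
  set W := ((A i) ×ˢ ((B i) ×ˢ (C i))).image fun q : ZMod p × ZMod p × ZMod p => (0 : ZMod p) + q.2.2 - q.1 - q.2.1 with hW
  set Sn := (A i).image (fun x => (0 : ZMod p) - x) with hSn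
  set Yo := DU B C (univ.erase i) with hYo
  set Zo := DU A C (univ.erase i) with hZo
  have hWcard : #W = vol := by rw [hW, card_image_blockSum hS i 0, hvol]
  have hWV : Disjoint W (Sn + Yo) := disjoint_W_negA_add_DU hS i
  have hYocard : #Yo = L := by rw [hYo, card_DU_BC hS hA, hL]
  have hZocard : #Zo = z := by rw [hZo, card_DU_AC hS hB, hz]
  obtain ⟨α, hα⟩ := hAap
  obtain ⟨β, hβ⟩ := hBap
  obtain ⟨y₀, hy⟩ := hYap
  obtain ⟨z₀, hzo⟩ := hZoap
  obtain ⟨v, hv⟩ := hVap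
  rw [ha] at hα; rw [hb] at hβ; rw [hYocard] at hy; rw [hZocard] at hzo
  -- counting: |V| = n, Sn + Yo an m-term progression
  have hSna : Sn = apFinset (0 - α - a' • e) e (a' + 1) := by rw [hSn, hα, image_sub_apFinset]
  have hsubm : Sn + Yo ⊆ apFinset (0 - α - a' • e + y₀) e m := by
    have h := apFinset_add_apFinset_subset (0 - α - a' • e) y₀ e (a' + 1) L
    rw [show a' + 1 + L - 1 = m by omega] at h
    rwa [hSna, hy]
  have hlem : #(Sn + Yo) ≤ m := (Finset.card_le_card hsubm).trans (card_apFinset_le _ _ _)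
  have hU : #(univ \ Zo) = p - z := by
    rw [Finset.card_sdiff_of_subset (Finset.subset_univ _), Finset.card_univ, ZMod.card, hZocard]
  have hBV : #(B i + (W ∪ (Sn + Yo))) ≤ (b' + 1) + #(W ∪ (Sn + Yo)) - 1 := by
    have h := (Finset.card_le_card (apFinset_add_apFinset_subset β v e' (b' + 1) #(W ∪ (Sn + Yo)))).trans (card_apFinset_le _ _ _)
    rwa [← hβ, ← hv] at h
  rw [hEq, hU] at hBV
  have hVcard : #(W ∪ (Sn + Yo)) = #W + #(Sn + Yo) := Finset.card_union_of_disjoint hWV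
  have hSYcard : #(Sn + Yo) = m := by omega
  have hVn : #(W ∪ (Sn + Yo)) = n := by omega
  have hSY : Sn + Yo = apFinset (0 - α - a' • e + y₀) e m := Finset.eq_of_subset_of_card_le hsubm (by rw [hSYcard, card_apFinset he (by omega)])
  rw [hVn] at hv
  -- the table
  obtain ⟨hSsub', hgap⟩ := prefix_law_of_runs hS i (SY := Sn + Yo) (N₁ := n) he' hβ hWV hv (by omega)
  rw [hSY, image_affine_apFinset] at hSsub' hgap
  have hval := val_mem_of_nat_table_prime (p := p) (n := n) (m := m) (r := b' + 1) (J := Js) (by omega) (by omega) htable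
    (mul_ne_zero (inv_ne_zero he') he) hSsub' hgap
  rcases hsplit _ hval with hword | hcover
  · -- word ratios
    have hApairs : ∀ k, 1 ≤ k → k < a' + 1 → ∃ x, x ∈ A i ∧ x + k • e ∈ A i := pairs_of_apFinset hα
    have hBpairs : ∀ k, 1 ≤ k → k < b' + 1 → ∃ x, x ∈ B i ∧ x + k • e' ∈ B i := pairs_of_apFinset hβ
    exact false_of_ratio_val_mem_mult hS i he he' (by omega) (by omega) (J := {(e'⁻¹ * e).val}) (fun jv hjv => by
      rw [Finset.mem_singleton] at hjv; rw [hjv]; exact hword) (Finset.mem_singleton_self _) hApairs hBpairs (hC i)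
  · -- exact cover: normalise block by block and run the sound search
    exfalso
    set u : ZMod p := e'⁻¹ with hu
    set j : ZMod p := u * e with hj
    have hu0 : u ≠ 0 := inv_ne_zero he'
    have hue : u * e' = 1 := inv_mul_cancel₀ he'
    have hbs : ∀ k, ∃ x, x ∈ B k := fun k => hB k
    choose bs hbsmem using hbs
    set φB : Fin N → ZMod p → ZMod p := fun k x => u * (x - bs k) with hφB
    set φC : Fin N → ZMod p → ZMod p := fun k x => u * (x - bs k - y₀) with hφC
    set φA : Fin N → ZMod p → ZMod p := fun k x => u * (x - bs k - y₀ + z₀) with hφA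
    have hinjB : ∀ k, Function.Injective (φB k) := fun k x x' h => by
      have := mul_left_cancel₀ hu0 h; simpa using this
    have hinjC : ∀ k, Function.Injective (φC k) := fun k x x' h => by
      have := mul_left_cancel₀ hu0 h; simpa using this
    have hinjA : ∀ k, Function.Injective (φA k) := fun k x x' h => by
      have := mul_left_cancel₀ hu0 h; simpa using this
    have hvinj : Function.Injective (ZMod.val : ZMod p → ℕ) := ZMod.val_injective p
    set Av : Fin N → Finset ℕ := fun k => (A k).image (fun x => (φA k x).val) with hAv
    set Bv : Fin N → Finset ℕ := fun k => (B k).image (fun x => (φB k x).val) with hBv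
    set Cv : Fin N → Finset ℕ := fun k => (C k).image (fun x => (φC k x).val) with hCv
    -- differences of normalised values
    have hdiffCB : ∀ k, ∀ c₀ ∈ C k, ∀ b₀ ∈ B k, ((φC k c₀).val + p - (φB k b₀).val) % p = (u * (c₀ - b₀ - y₀)).val := by
      intro k c₀ _ b₀ _
      rw [← val_sub_eq_mod]
      congr 1
      simp only [hφC, hφB]; ring
    have hdiffCA : ∀ k, ∀ c₀ ∈ C k, ∀ a₀ ∈ A k, ((φC k c₀).val + p - (φA k a₀).val) % p = (u * (c₀ - a₀ - z₀)).val := by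
      intro k c₀ _ a₀ _
      rw [← val_sub_eq_mod]
      congr 1
      simp only [hφC, hφA]; ring
    have hdiffAB : ∀ k, ∀ a₀ ∈ A k, ∀ b₀ ∈ B k, ((φA k a₀).val + p - (φB k b₀).val) % p = (u * (a₀ - b₀ - y₀ + z₀)).val := by
      intro k a₀ _ b₀ _
      rw [← val_sub_eq_mod]
      congr 1
      simp only [hφA, hφB]; ring
    -- elements of the difference sets of other blocks lie in Y° / Z°
    have hYmem : ∀ k, k ≠ i → ∀ c₀ ∈ C k, ∀ b₀ ∈ B k, ∃ t, t < L ∧ c₀ - b₀ = y₀ + t • e := by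
      intro k hk c₀ hc₀ b₀ hb₀
      have h : c₀ - b₀ ∈ Yo := D_subset_DU (Finset.mem_erase.2 ⟨hk, Finset.mem_univ k⟩) (mem_D.2 ⟨b₀, hb₀, c₀, hc₀, rfl⟩)
      rw [hy, mem_apFinset] at h
      obtain ⟨t, ht, h⟩ := h
      exact ⟨t, ht, h.symm⟩
    have hZmem : ∀ k, k ≠ i → ∀ c₀ ∈ C k, ∀ a₀ ∈ A k, ∃ t, t < z ∧ c₀ - a₀ = z₀ + t • e' := by
      intro k hk c₀ hc₀ a₀ ha₀
      have h : c₀ - a₀ ∈ Zo := D_subset_DU (Finset.mem_erase.2 ⟨hk, Finset.mem_univ k⟩) (mem_D.2 ⟨a₀, ha₀, c₀, hc₀, rfl⟩)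
      rw [hzo, mem_apFinset] at h
      obtain ⟨t, ht, h⟩ := h
      exact ⟨t, ht, h.symm⟩
    have hvalYt : ∀ t : ℕ, (u * (y₀ + t • e - y₀)).val = (j.val * t) % p := by
      intro t
      have : u * (y₀ + t • e - y₀) = 0 + t • j := by rw [hj, nsmul_eq_mul, nsmul_eq_mul]; ring
      rw [this, val_add_nsmul_zmod, ZMod.val_zero, zero_add]
    have hzp : z ≤ p := by have h := Finset.card_le_univ Zo; rwa [hZocard, ZMod.card] at h
    have hvalZt : ∀ t : ℕ, t < z → (u * (z₀ + t • e' - z₀)).val = t := by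
      intro t ht
      have : u * (z₀ + t • e' - z₀) = (t : ZMod p) := by rw [nsmul_eq_mul]; linear_combination (t : ZMod p) * hue
      rw [this, ZMod.val_natCast, Nat.mod_eq_of_lt (by omega)]
    -- run the sound search
    have hLp : L ≤ p := by have h := Finset.card_le_univ Yo; rwa [hYocard, ZMod.card] at h
    have hj0 : j ≠ 0 := mul_ne_zero hu0 he
    have hYLnd : ((List.range L).map fun t => (j.val * t) % p).Nodup := by
      refine List.Nodup.map_on ?_ (List.nodup_range)
      intro t ht t' ht' h
      rw [List.mem_range] at ht ht'
      refine zmod_natMul_injOn (t := (0 : ZMod p)) hj0 (by omega) (by omega) ?_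
      apply ZMod.val_injective p
      rw [val_add_nsmul_zmod, val_add_nsmul_zmod, ZMod.val_zero, zero_add, zero_add]
      exact h
    have hiA : ∀ k, Function.Injective (fun x => (φA k x).val) := fun k x x' h => hinjA k (hvinj h)
    have hiB : ∀ k, Function.Injective (fun x => (φB k x).val) := fun k x x' h => hinjB k (hvinj h)
    have hiC : ∀ k, Function.Injective (fun x => (φC k x).val) := fun k x x' h => hinjC k (hvinj h)
    have hksne : ∀ k ∈ ks, k ≠ i := fun k hk => (hksi k).1 hk
    have htrue := existsCover_complete (p := p) (z := z) hYLnd (fun k => k ≠ i) (fun k => (#(A k), #(B k), #(C k))) Av Bv Cv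
      (fun k _ => by simp only [hAv]; rw [Finset.card_image_of_injective _ (hiA k)])
      (fun k _ => by simp only [hBv]; rw [Finset.card_image_of_injective _ (hiB k)])
      (fun k _ => by simp only [hCv]; rw [Finset.card_image_of_injective _ (hiC k)])
      (fun k x hx => by obtain ⟨y, -, rfl⟩ := Finset.mem_image.1 hx; exact ZMod.val_lt _)
      (fun k x hx => by obtain ⟨y, -, rfl⟩ := Finset.mem_image.1 hx; exact ZMod.val_lt _)
      (fun k x hx => by obtain ⟨y, -, rfl⟩ := Finset.mem_image.1 hx; exact ZMod.val_lt _)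
      (fun k _ => Finset.mem_image.2 ⟨bs k, hbsmem k, by simp [hφB]⟩)
      ?hY ?hZ ?hinjY ?hinjZ ?hinjX ks hks hksne [] [] (by simp) ?hdY ?hcY (by simp) ?hdZ ?hcZ
    · rw [hcover] at htrue; exact Bool.noConfusion htrue
    case hY =>
      intro k hk c hc x hx
      obtain ⟨c₀, hc₀, rfl⟩ := Finset.mem_image.1 hc
      obtain ⟨b₀, hb₀, rfl⟩ := Finset.mem_image.1 hx
      obtain ⟨t, ht, hcb⟩ := hYmem k hk c₀ hc₀ b₀ hb₀
      rw [hdiffCB k c₀ hc₀ b₀ hb₀, hcb, hvalYt]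
      exact List.mem_map.2 ⟨t, List.mem_range.2 ht, rfl⟩
    case hZ =>
      intro k hk c hc x hx
      obtain ⟨c₀, hc₀, rfl⟩ := Finset.mem_image.1 hc
      obtain ⟨a₀, ha₀, rfl⟩ := Finset.mem_image.1 hx
      obtain ⟨t, ht, hca⟩ := hZmem k hk c₀ hc₀ a₀ ha₀
      rw [hdiffCA k c₀ hc₀ a₀ ha₀, hca, hvalZt t ht]
      exact ht
    case hinjY =>
      intro k _ c hc c' hc' x hx x' hx' heq
      obtain ⟨c₀, hc₀, rfl⟩ := Finset.mem_image.1 hc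
      obtain ⟨c₁, hc₁, rfl⟩ := Finset.mem_image.1 hc'
      obtain ⟨b₀, hb₀, rfl⟩ := Finset.mem_image.1 hx
      obtain ⟨b₁, hb₁, rfl⟩ := Finset.mem_image.1 hx'
      rw [hdiffCB k c₀ hc₀ b₀ hb₀, hdiffCB k c₁ hc₁ b₁ hb₁] at heq
      have h1 : c₀ - b₀ = c₁ - b₁ := by
        have := mul_left_cancel₀ hu0 (hvinj heq); linear_combination this
      obtain ⟨e1, e2⟩ := sub_injOn_of_card_D (card_D_BC hS hA k) hb₀ hb₁ hc₀ hc₁ h1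
      exact ⟨by rw [e2], by rw [e1]⟩
    case hinjZ =>
      intro k _ c hc c' hc' x hx x' hx' heq
      obtain ⟨c₀, hc₀, rfl⟩ := Finset.mem_image.1 hc
      obtain ⟨c₁, hc₁, rfl⟩ := Finset.mem_image.1 hc'
      obtain ⟨a₀, ha₀, rfl⟩ := Finset.mem_image.1 hx
      obtain ⟨a₁, ha₁, rfl⟩ := Finset.mem_image.1 hx'
      rw [hdiffCA k c₀ hc₀ a₀ ha₀, hdiffCA k c₁ hc₁ a₁ ha₁] at heq
      have h1 : c₀ - a₀ = c₁ - a₁ := by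
        have := mul_left_cancel₀ hu0 (hvinj heq); linear_combination this
      obtain ⟨e1, e2⟩ := sub_injOn_of_card_D (card_D_AC hS hB k) ha₀ ha₁ hc₀ hc₁ h1
      exact ⟨by rw [e2], by rw [e1]⟩
    case hinjX =>
      intro k _ c hc c' hc' x hx x' hx' heq
      obtain ⟨a₀, ha₀, rfl⟩ := Finset.mem_image.1 hc
      obtain ⟨a₁, ha₁, rfl⟩ := Finset.mem_image.1 hc'
      obtain ⟨b₀, hb₀, rfl⟩ := Finset.mem_image.1 hx
      obtain ⟨b₁, hb₁, rfl⟩ := Finset.mem_image.1 hx'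
      rw [hdiffAB k a₀ ha₀ b₀ hb₀, hdiffAB k a₁ ha₁ b₁ hb₁] at heq
      have h1 : b₀ - a₀ = b₁ - a₁ := by
        have := mul_left_cancel₀ hu0 (hvinj heq); linear_combination (-1 : ZMod p) * this
      obtain ⟨e1, e2⟩ := sub_injOn_of_card_D (card_D_AB hS hC k) ha₀ ha₁ hb₀ hb₁ h1
      exact ⟨by rw [e1], by rw [e2]⟩
    case hdY =>
      intro k hk k' hk' hne c hc x hx c' hc' x' hx' heq
      obtain ⟨c₀, hc₀, rfl⟩ := Finset.mem_image.1 hc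
      obtain ⟨b₀, hb₀, rfl⟩ := Finset.mem_image.1 hx
      obtain ⟨c₁, hc₁, rfl⟩ := Finset.mem_image.1 hc'
      obtain ⟨b₁, hb₁, rfl⟩ := Finset.mem_image.1 hx'
      rw [hdiffCB k c₀ hc₀ b₀ hb₀, hdiffCB k' c₁ hc₁ b₁ hb₁] at heq
      have h1 : c₀ - b₀ = c₁ - b₁ := by
        have := mul_left_cancel₀ hu0 (hvinj heq); linear_combination this
      have hm0 : c₀ - b₀ ∈ D B C k := mem_D.2 ⟨b₀, hb₀, c₀, hc₀, rfl⟩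
      have hm1 : c₁ - b₁ ∈ D B C k' := mem_D.2 ⟨b₁, hb₁, c₁, hc₁, rfl⟩
      rw [h1] at hm0
      exact Finset.disjoint_left.1 (disjoint_D_BC hS hA hne) hm0 hm1
    case hcY =>
      intro y hyin
      obtain ⟨t, ht, rfl⟩ := List.mem_map.1 hyin
      rw [List.mem_range] at ht
      have hmem : y₀ + t • e ∈ Yo := by rw [hy]; exact mem_apFinset.2 ⟨t, ht, rfl⟩
      obtain ⟨k, hk, hyk⟩ := Finset.mem_biUnion.1 hmem
      obtain ⟨b₀, hb₀, c₀, hc₀, hcb⟩ := mem_D.1 hyk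
      refine Or.inr ⟨k, (hksi k).2 (Finset.mem_erase.1 hk).1, (φC k c₀).val, Finset.mem_image.2 ⟨c₀, hc₀, rfl⟩,
        (φB k b₀).val, Finset.mem_image.2 ⟨b₀, hb₀, rfl⟩, ?_⟩
      rw [hdiffCB k c₀ hc₀ b₀ hb₀, hcb, hvalYt]
    case hdZ =>
      intro k hk k' hk' hne c hc x hx c' hc' x' hx' heq
      obtain ⟨c₀, hc₀, rfl⟩ := Finset.mem_image.1 hc
      obtain ⟨a₀, ha₀, rfl⟩ := Finset.mem_image.1 hx
      obtain ⟨c₁, hc₁, rfl⟩ := Finset.mem_image.1 hc'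
      obtain ⟨a₁, ha₁, rfl⟩ := Finset.mem_image.1 hx'
      rw [hdiffCA k c₀ hc₀ a₀ ha₀, hdiffCA k' c₁ hc₁ a₁ ha₁] at heq
      have h1 : c₀ - a₀ = c₁ - a₁ := by
        have := mul_left_cancel₀ hu0 (hvinj heq); linear_combination this
      have hm0 : c₀ - a₀ ∈ D A C k := mem_D.2 ⟨a₀, ha₀, c₀, hc₀, rfl⟩
      have hm1 : c₁ - a₁ ∈ D A C k' := mem_D.2 ⟨a₁, ha₁, c₁, hc₁, rfl⟩
      rw [h1] at hm0
      exact Finset.disjoint_left.1 (disjoint_D_AC hS hB hne) hm0 hm1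
    case hcZ =>
      intro t ht
      have hmem : z₀ + t • e' ∈ Zo := by rw [hzo]; exact mem_apFinset.2 ⟨t, ht, rfl⟩
      obtain ⟨k, hk, hzk⟩ := Finset.mem_biUnion.1 hmem
      obtain ⟨a₀, ha₀, c₀, hc₀, hca⟩ := mem_D.1 hzk
      refine Or.inr ⟨k, (hksi k).2 (Finset.mem_erase.1 hk).1, (φC k c₀).val, Finset.mem_image.2 ⟨c₀, hc₀, rfl⟩,
        (φA k a₀).val, Finset.mem_image.2 ⟨a₀, ha₀, rfl⟩, ?_⟩
      rw [hdiffCA k c₀ hc₀ a₀ ha₀, hca, hvalZt t ht]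

end Summit.MatrixMultiplication.OmegaCensus.CubeNB
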